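import Summits.AtomisticToContinuum.Crystallization.Theorems.ChartedPlanarOrderPlanesCount

/-!
# Planes line, P2b — the TOTAL VARIATION of the layer counts of a cube chunk is a collar count (slot 7b seed, decomp-a2c lens-3)

For a cube chunk `F = Y ∩ cube(c, ℓ)` of a layered set `Y = Layered a b w` (indexed family `pt`, layer counts `N k`), and REDUCED
inter-layer shifts of length `≤ R` (`∀ j, ∃ p q : ℤ, ‖(w (j+1) − w j) + (p•a + q•b)‖ ≤ R`): translating layer `j` by the reduced shift is a
bijection onto layer `j+1` moving every point by `≤ R`, so only points of the INNER COLLAR `IC_R = {z ∈ cube : some coordinate within R of a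
face}` can enter or leave the cube:  `|N (j+1) − N j| ≤ #(layer j+1 ∩ IC_R) + #(layer j ∩ IC_R)`, hence for every finite set of gaps `J`,
★ `Σ_{j ∈ J} |N (j+1) − N j| ≤ 2 · #(F ∩ IC_R) ≤ 12 (2ℓ/δ + 1)² (2R/δ + 1)` for `δ`-separated `Y` — O(ℓ²), with NO lattice-point
asymptotics and no hypothesis on the direction of the layers (memo PLAN-7b §4 (c)).
(`idx`, `layerCount` are those of P2a `…ChartedPlanarOrderPlanesCount`.  The same shell mechanism, for the layer profile of a cube chunk
indexed by `layerOf`, is lens-4's `…OverbindingBudgetEnergyThinProfiles.sum_abs_layerCount_sub_le` (landed first, p829404); the two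
`layerCount`s are distinct objects — here the count is over the index set `idx` of P2a and the collar is the inner collar of width `R`.)
-/

namespace Summit.AtomisticToContinuum.Crystallization.Theorems.ChartedPlanarOrderPlanesCollar

open scoped BigOperators RealInnerProductSpace
open Summit.AtomisticToContinuum.Crystallization.Theorems.ChartedPlanarOrderRigidityDoor (E3)
open Summit.AtomisticToContinuum.Crystallization.Theorems.ChartedPlanarOrderDoorLayered (Layered)
open Summit.AtomisticToContinuum.Crystallization.Theorems.OverbindingBudgetCubeTails (card_le_of_separated_of_box)
open Summit.AtomisticToContinuum.Crystallization.Theorems.ChartedPlanarOrderNashForceBalance (layerPoint layerPoint_mem)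
open Summit.AtomisticToContinuum.Crystallization.Theorems.ChartedPlanarOrderPlanesCount (idx layerCount)

/-! ## §1 Cubes and inner collars -/

/-- the half-open axis-parallel cube of `StressFree`. -/
def cube (c : E3) (ℓ : ℝ) : Set E3 := {z | ∀ i : Fin 3, c i ≤ z i ∧ z i < c i + ℓ}

/-- the inner collar of width `R`: points of the cube with some coordinate within `R` of a face. -/
def innerCollar (c : E3) (ℓ R : ℝ) : Set E3 :=
  {z | (∀ i : Fin 3, c i ≤ z i ∧ z i < c i + ℓ) ∧ ∃ i : Fin 3, z i < c i + R ∨ c i + ℓ - R ≤ z i}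

/-- a cube point whose `d`-translate leaves the cube lies in the inner collar of width `‖d‖ ≤ R`. -/
theorem mem_innerCollar_of_add {c z d : E3} {ℓ R : ℝ} (hz : z ∈ cube c ℓ) (hzd : z + d ∉ cube c ℓ) (hd : ‖d‖ ≤ R) :
    z ∈ innerCollar c ℓ R := by
  refine ⟨hz, ?_⟩
  simp only [cube, Set.mem_setOf_eq, not_forall] at hzd
  obtain ⟨i, hi⟩ := hzd
  refine ⟨i, ?_⟩
  have hdi : |d i| ≤ R := by
    have h := PiLp.norm_apply_le d i
    rw [Real.norm_eq_abs] at h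
    exact h.trans hd
  have h1 := (abs_le.mp hdi).1
  have h2 := (abs_le.mp hdi).2
  have hzi := hz i
  rw [not_and_or] at hi
  rcases hi with hi | hi
  · -- (z + d) i < c i  ⇒ z i < c i + R
    left
    have : (z + d) i = z i + d i := rfl
    push Not at hi
    linarith
  · right
    have : (z + d) i = z i + d i := rfl
    push Not at hi
    linarith

/-- the same for the `−d`-translate. -/
theorem mem_innerCollar_of_sub {c z d : E3} {ℓ R : ℝ} (hz : z ∈ cube c ℓ) (hzd : z - d ∉ cube c ℓ) (hd : ‖d‖ ≤ R) :
    z ∈ innerCollar c ℓ R := by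
  refine mem_innerCollar_of_add hz (d := -d) (by rwa [← sub_eq_add_neg]) (by rwa [norm_neg])

/-! ## §2 Shifting the indexed family `layerPoint` (tree) by one layer and a cell vector -/

/-- the shift of an index by one layer and a cell vector. -/
def shift (p q : ℤ) (s : ℤ × ℤ × ℤ) : ℤ × ℤ × ℤ := (s.1 + 1, s.2.1 + p, s.2.2 + q)

/-- its inverse. -/
def unshift (p q : ℤ) (s : ℤ × ℤ × ℤ) : ℤ × ℤ × ℤ := (s.1 - 1, s.2.1 - p, s.2.2 - q)

/-- `shift` after `unshift` is the identity. -/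
theorem shift_unshift (p q : ℤ) (s : ℤ × ℤ × ℤ) : shift p q (unshift p q s) = s := by
  obtain ⟨m, i, k⟩ := s
  simp [shift, unshift]

/-- `unshift` after `shift` is the identity. -/
theorem unshift_shift (p q : ℤ) (s : ℤ × ℤ × ℤ) : unshift p q (shift p q s) = s := by
  obtain ⟨m, i, k⟩ := s
  simp [shift, unshift]

/-- `shift p q` is injective. -/
theorem shift_injective (p q : ℤ) : Function.Injective (shift p q) :=
  fun s t h => by rw [← unshift_shift p q s, h, unshift_shift]

/-- `unshift p q` is injective. -/
theorem unshift_injective (p q : ℤ) : Function.Injective (unshift p q) :=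
  fun s t h => by rw [← shift_unshift p q s, h, shift_unshift]

/-- ★ the shifted index is the translated point: `layerPoint (shift p q s) = layerPoint s + ((w (s.1+1) − w s.1) + (p•a + q•b))`. -/
theorem layerPoint_shift (a b : E3) (w : ℤ → E3) (p q : ℤ) (s : ℤ × ℤ × ℤ) :
    layerPoint a b w (shift p q s) = layerPoint a b w s + ((w (s.1 + 1) - w s.1) + (((p : ℝ) • a) + ((q : ℝ) • b))) := by
  obtain ⟨m, i, k⟩ := s
  simp only [layerPoint, shift, Int.cast_add, add_smul]
  abel

/-! ## §3 The total variation of the layer counts -/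

section chunk
variable {a b : E3} {w : ℤ → E3} {c : E3} {ℓ R : ℝ}

variable (hinj : Function.Injective (layerPoint a b w)) (F : Finset E3)
  (hF : (↑F : Set E3) = Layered a b w ∩ cube c ℓ)

include hF in
/-- membership in the index set is membership of the point in the cube. -/
theorem mem_idx_iff {s : ℤ × ℤ × ℤ} : s ∈ idx a b w hinj F ↔ layerPoint a b w s ∈ cube c ℓ := by
  unfold idx
  rw [Finset.mem_preimage, ← Finset.mem_coe, hF]
  exact ⟨fun h => h.2, fun h => ⟨layerPoint_mem s, h⟩⟩

open Classical in
include hF in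
/-- ★ one gap: `|N (j+1) − N j| ≤ #(layer j+1 ∩ IC_R) + #(layer j ∩ IC_R)` given a reduced shift of length `≤ R`. -/
theorem abs_layerCount_sub_le (j : ℤ) {p q : ℤ} (hR : ‖(w (j + 1) - w j) + (((p : ℝ) • a) + ((q : ℝ) • b))‖ ≤ R) :
    |((layerCount hinj F (j + 1) : ℕ) : ℝ) - (layerCount hinj F j : ℕ)| ≤
      (((idx a b w hinj F).filter fun s => s.1 = j + 1 ∧ layerPoint a b w s ∈ innerCollar c ℓ R).card : ℝ) +
        (((idx a b w hinj F).filter fun s => s.1 = j ∧ layerPoint a b w s ∈ innerCollar c ℓ R).card : ℝ) := by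
  set S := idx a b w hinj F with hS
  set Sj := S.filter fun s => s.1 = j with hSj
  set Sj1 := S.filter fun s => s.1 = j + 1 with hSj1
  set T := Sj1.image (unshift p q) with hT
  -- the shifted layer-j set has the cardinality of layer j+1
  have hTcard : T.card = Sj1.card := Finset.card_image_of_injective _ (unshift_injective p q)
  -- key translation facts
  have hshift_pt : ∀ s : ℤ × ℤ × ℤ, s.1 = j →
      layerPoint a b w (shift p q s) = layerPoint a b w s + ((w (j + 1) - w j) + (((p : ℝ) • a) + ((q : ℝ) • b))) := by
    intro s hs
    rw [layerPoint_shift, hs]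
  have memS : ∀ s, s ∈ S ↔ layerPoint a b w s ∈ cube c ℓ := fun s => mem_idx_iff hinj F hF
  -- |#T − #Sj| ≤ #(T \ Sj) + #(Sj \ T)
  have hcardT := Finset.card_sdiff_add_card_inter T Sj
  have hcardS := Finset.card_sdiff_add_card_inter Sj T
  have hinter : (T ∩ Sj).card = (Sj ∩ T).card := by rw [Finset.inter_comm]
  -- (1) T \ Sj injects into layer j+1 ∩ IC by `shift`
  have h1 : (T \ Sj).card ≤ (S.filter fun s => s.1 = j + 1 ∧ layerPoint a b w s ∈ innerCollar c ℓ R).card := by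
    refine Finset.card_le_card_of_injOn (shift p q) (fun t ht => ?_) ((shift_injective p q).injOn)
    rw [Finset.mem_coe, Finset.mem_sdiff] at ht
    obtain ⟨htT, htS⟩ := ht
    rw [hT, Finset.mem_image] at htT
    obtain ⟨s', hs', rfl⟩ := htT
    rw [hSj1, Finset.mem_filter] at hs'
    rw [shift_unshift]
    rw [Finset.mem_coe, Finset.mem_filter]
    refine ⟨hs'.1, hs'.2, ?_⟩
    have hj' : (unshift p q s').1 = j := by simp [unshift, hs'.2]
    have hnot : layerPoint a b w (unshift p q s') ∉ cube c ℓ := by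
      intro hc
      apply htS
      rw [hSj, Finset.mem_filter]
      exact ⟨(memS _).mpr hc, hj'⟩
    have hin : layerPoint a b w s' ∈ cube c ℓ := (memS _).mp hs'.1
    have e : layerPoint a b w s' = layerPoint a b w (unshift p q s') + ((w (j + 1) - w j) + (((p : ℝ) • a) + ((q : ℝ) • b))) := by
      rw [← hshift_pt _ hj', shift_unshift]
    refine mem_innerCollar_of_sub hin ?_ hR
    rwa [e, add_sub_cancel_right]
  -- (2) Sj \ T ⊆ layer j ∩ IC
  have h2 : (Sj \ T).card ≤ (S.filter fun s => s.1 = j ∧ layerPoint a b w s ∈ innerCollar c ℓ R).card := by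
    refine Finset.card_le_card fun s hs => ?_
    rw [Finset.mem_sdiff] at hs
    obtain ⟨hsS, hsT⟩ := hs
    rw [hSj, Finset.mem_filter] at hsS
    rw [Finset.mem_filter]
    refine ⟨hsS.1, hsS.2, ?_⟩
    have hin : layerPoint a b w s ∈ cube c ℓ := (memS _).mp hsS.1
    have hnot : layerPoint a b w (shift p q s) ∉ cube c ℓ := by
      intro hc
      apply hsT
      rw [hT, Finset.mem_image]
      refine ⟨shift p q s, ?_, unshift_shift p q s⟩
      rw [hSj1, Finset.mem_filter]
      exact ⟨(memS _).mpr hc, by simp [shift, hsS.2]⟩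
    rw [hshift_pt s hsS.2] at hnot
    exact mem_innerCollar_of_add hin hnot hR
  -- assemble
  have eN1 : layerCount hinj F (j + 1) = Sj1.card := rfl
  have eN0 : layerCount hinj F j = Sj.card := rfl
  rw [eN1, eN0, ← hTcard]
  have : |((T.card : ℕ) : ℝ) - (Sj.card : ℕ)| ≤ ((T \ Sj).card : ℝ) + ((Sj \ T).card : ℝ) := by
    rw [abs_le]
    constructor
    · have := hcardS; push_cast [← this, ← hcardT, hinter] at *; linarith
    · have := hcardT; push_cast [← this, ← hcardS, hinter] at *; linarith
  calc |((T.card : ℕ) : ℝ) - (Sj.card : ℕ)| ≤ ((T \ Sj).card : ℝ) + ((Sj \ T).card : ℝ) := this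
    _ ≤ _ := by gcongr

open Classical in
include hF in
/-- ★ **total variation ≤ twice the collar count**, for any finite set of gaps. -/
theorem sum_abs_layerCount_sub_le (J : Finset ℤ)
    (hshift : ∀ j : ℤ, ∃ p q : ℤ, ‖(w (j + 1) - w j) + (((p : ℝ) • a) + ((q : ℝ) • b))‖ ≤ R) :
    ∑ j ∈ J, |((layerCount hinj F (j + 1) : ℕ) : ℝ) - (layerCount hinj F j : ℕ)| ≤
      2 * (((idx a b w hinj F).filter fun s => layerPoint a b w s ∈ innerCollar c ℓ R).card : ℝ) := by
  set S := idx a b w hinj F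
  set C := S.filter fun s => layerPoint a b w s ∈ innerCollar c ℓ R with hC
  -- per-gap bound, then the two fibre sums are each ≤ #C
  have step : ∀ j ∈ J, |((layerCount hinj F (j + 1) : ℕ) : ℝ) - (layerCount hinj F j : ℕ)| ≤
      ((C.filter fun s => s.1 = j + 1).card : ℝ) + ((C.filter fun s => s.1 = j).card : ℝ) := by
    intro j _
    obtain ⟨p, q, hR⟩ := hshift j
    have key := abs_layerCount_sub_le hinj F hF j hR
    have e1 : (S.filter fun s => s.1 = j + 1 ∧ layerPoint a b w s ∈ innerCollar c ℓ R) = C.filter fun s => s.1 = j + 1 := by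
      rw [hC, Finset.filter_filter]; congr 1; ext s; tauto
    have e0 : (S.filter fun s => s.1 = j ∧ layerPoint a b w s ∈ innerCollar c ℓ R) = C.filter fun s => s.1 = j := by
      rw [hC, Finset.filter_filter]; congr 1; ext s; tauto
    rw [e1, e0] at key
    exact key
  refine (Finset.sum_le_sum step).trans ?_
  rw [Finset.sum_add_distrib, two_mul]
  have fib : ∀ g : ℤ → ℤ, Function.Injective g →
      ∑ j ∈ J, ((C.filter fun s => s.1 = g j).card : ℝ) ≤ (C.card : ℝ) := by
    intro g hg
    have : ∑ j ∈ J, (C.filter fun s => s.1 = g j).card ≤ C.card := by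
      rw [← Finset.card_biUnion]
      · exact Finset.card_le_card (Finset.biUnion_subset.mpr fun j _ => Finset.filter_subset _ _)
      · intro j _ j' _ hjj'
        refine Finset.disjoint_filter.mpr fun s _ h1 h2 => hjj' (hg (h1.symm.trans h2))
    exact_mod_cast this
  have hA := fib (fun j => j + 1) fun x y h => by simpa using h
  have hB := fib (fun j => j) fun x y h => h
  linarith

/-! ## §4 The collar count is O(ℓ²) -/

omit hinj F in
/-- a `δ`-separated finset inside a slab-box with two sides `ℓ` and one side `m` has `≤ (2ℓ/δ+1)² (2m/δ+1)` points. -/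
theorem card_slab_le (Q : Finset E3) (a₀ : Fin 3 → ℝ) (i : Fin 3) {m δ : ℝ} (hδ : 0 < δ) (hℓ : 0 ≤ ℓ) (hm : 0 ≤ m)
    (hQ : ∀ z ∈ Q, ∀ k, a₀ k ≤ z k ∧ z k < a₀ k + Function.update (fun _ : Fin 3 => ℓ) i m k)
    (hsep : ∀ z ∈ Q, ∀ z' ∈ Q, z ≠ z' → δ ≤ dist z z') :
    (Q.card : ℝ) ≤ (2 * ℓ / δ + 1) ^ 2 * (2 * m / δ + 1) := by
  have key := card_le_of_separated_of_box Q a₀ (Function.update (fun _ : Fin 3 => ℓ) i m) hδ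
    (fun k => by rw [Function.update_apply]; split_ifs <;> assumption) hQ hsep
  refine key.trans (le_of_eq ?_)
  have e : ∀ k ∈ (Finset.univ : Finset (Fin 3)), 2 * Function.update (fun _ : Fin 3 => ℓ) i m k / δ + 1 =
      Function.update (fun _ : Fin 3 => 2 * ℓ / δ + 1) i (2 * m / δ + 1) k := by
    intro k _
    rw [Function.update_apply, Function.update_apply]
    split_ifs <;> rfl
  rw [Finset.prod_congr rfl e, Finset.prod_update_of_mem (Finset.mem_univ i)]
  have hcard : (Finset.univ \ {i} : Finset (Fin 3)).card = 2 := by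
    rw [Finset.card_univ_sdiff]; simp
  rw [Finset.prod_const, hcard]
  ring

open Classical in
omit hF in
/-- ★ `#(F ∩ IC_R) ≤ 6 (2ℓ/δ + 1)² (2R/δ + 1)` for `δ`-separated `Y` (six slabs, `card_le_of_separated_of_box`). -/
theorem card_collar_le {δ : ℝ} (hδ : 0 < δ) (hℓ : 0 ≤ ℓ) (hR : 0 ≤ R)
    (hsep : ∀ z ∈ Layered a b w, ∀ z' ∈ Layered a b w, z ≠ z' → δ ≤ dist z z') :
    (((idx a b w hinj F).filter fun s => layerPoint a b w s ∈ innerCollar c ℓ R).card : ℝ) ≤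
      6 * ((2 * ℓ / δ + 1) ^ 2 * (2 * R / δ + 1)) := by
  set S := idx a b w hinj F
  set P := (S.filter fun s => layerPoint a b w s ∈ innerCollar c ℓ R).image (layerPoint a b w) with hP
  have hPcard : P.card = (S.filter fun s => layerPoint a b w s ∈ innerCollar c ℓ R).card :=
    Finset.card_image_of_injective _ hinj
  have hPmem : ∀ z ∈ P, z ∈ Layered a b w ∧ z ∈ innerCollar c ℓ R := by
    intro z hz
    rw [hP, Finset.mem_image] at hz
    obtain ⟨s, hs, rfl⟩ := hz
    rw [Finset.mem_filter] at hs
    exact ⟨layerPoint_mem s, hs.2⟩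
  have sepP : ∀ z ∈ P, ∀ z' ∈ P, z ≠ z' → δ ≤ dist z z' :=
    fun z hz z' hz' h => hsep z (hPmem z hz).1 z' (hPmem z' hz').1 h
  -- the six slabs
  set lo : Fin 3 → Finset E3 := fun i => P.filter fun z => z i < c i + R with hlo
  set hi : Fin 3 → Finset E3 := fun i => P.filter fun z => c i + ℓ - R ≤ z i with hhi
  have hcover : P ⊆ Finset.univ.biUnion fun i => lo i ∪ hi i := by
    intro z hz
    obtain ⟨_, _, i, hi'⟩ := hPmem z hz
    rw [Finset.mem_biUnion]
    refine ⟨i, Finset.mem_univ _, ?_⟩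
    rw [Finset.mem_union]
    rcases hi' with h | h
    · exact Or.inl (Finset.mem_filter.mpr ⟨hz, h⟩)
    · exact Or.inr (Finset.mem_filter.mpr ⟨hz, h⟩)
  have hm : 0 ≤ min R ℓ := le_min hR hℓ
  have hmin : (2 * ℓ / δ + 1) ^ 2 * (2 * min R ℓ / δ + 1) ≤ (2 * ℓ / δ + 1) ^ 2 * (2 * R / δ + 1) := by
    have : 2 * min R ℓ / δ ≤ 2 * R / δ := by
      apply div_le_div_of_nonneg_right _ hδ.le; linarith [min_le_left R ℓ]
    have h1 : 0 ≤ (2 * ℓ / δ + 1) ^ 2 := by positivity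
    nlinarith
  have boxlo : ∀ i, ((lo i).card : ℝ) ≤ (2 * ℓ / δ + 1) ^ 2 * (2 * R / δ + 1) := by
    intro i
    refine (card_slab_le (ℓ := ℓ) (lo i) (fun k => c k) i hδ hℓ hm (fun z hz k => ?_)
      (fun z hz z' hz' h => sepP z (Finset.mem_filter.mp hz).1 z' (Finset.mem_filter.mp hz').1 h)).trans hmin
    have hz' := Finset.mem_filter.mp hz
    obtain ⟨_, hzc, _⟩ := hPmem z hz'.1
    have hk := hzc k
    by_cases hki : k = i
    · subst hki
      rw [Function.update_self, ← min_add_add_left]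
      exact ⟨hk.1, lt_min hz'.2 hk.2⟩
    · rw [Function.update_of_ne hki]
      exact hk
  have boxhi : ∀ i, ((hi i).card : ℝ) ≤ (2 * ℓ / δ + 1) ^ 2 * (2 * R / δ + 1) := by
    intro i
    refine (card_slab_le (ℓ := ℓ) (hi i) (Function.update (fun k => c k) i (c i + ℓ - min R ℓ)) i hδ hℓ hm
      (fun z hz k => ?_)
      (fun z hz z' hz' h => sepP z (Finset.mem_filter.mp hz).1 z' (Finset.mem_filter.mp hz').1 h)).trans hmin
    have hz' := Finset.mem_filter.mp hz
    obtain ⟨_, hzc, _⟩ := hPmem z hz'.1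
    have hk := hzc k
    by_cases hki : k = i
    · subst hki
      rw [Function.update_self, Function.update_self]
      refine ⟨?_, by linarith [hk.2]⟩
      rcases le_total R ℓ with h | h
      · rw [min_eq_left h]; linarith [hz'.2]
      · rw [min_eq_right h]; linarith [hk.1]
    · rw [Function.update_of_ne hki, Function.update_of_ne hki]
      exact hk
  -- assemble
  rw [← hPcard]
  have h1 : P.card ≤ ∑ i : Fin 3, ((lo i).card + (hi i).card) := by
    refine (Finset.card_le_card hcover).trans (Finset.card_biUnion_le.trans (Finset.sum_le_sum fun i _ => ?_))
    exact Finset.card_union_le _ _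
  have h2 : (P.card : ℝ) ≤ ∑ i : Fin 3, (((lo i).card : ℝ) + ((hi i).card : ℝ)) := by exact_mod_cast h1
  refine h2.trans ?_
  calc ∑ i : Fin 3, (((lo i).card : ℝ) + ((hi i).card : ℝ))
      ≤ ∑ _i : Fin 3, 2 * ((2 * ℓ / δ + 1) ^ 2 * (2 * R / δ + 1)) :=
        Finset.sum_le_sum fun i _ => by linarith [boxlo i, boxhi i]
    _ = 6 * ((2 * ℓ / δ + 1) ^ 2 * (2 * R / δ + 1)) := by
        rw [Finset.sum_const, Finset.card_univ, Fintype.card_fin]; ring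

end chunk

end Summit.AtomisticToContinuum.Crystallization.Theorems.ChartedPlanarOrderPlanesCollar
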